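import Summits.ResolutionOfSingularities.ResolutionOfSingularities.Theorems.DeltaCutGradeCells
import Summits.ResolutionOfSingularities.ResolutionOfSingularities.Theorems.DeltaCutGradeCertificates3
import Literature.AlgebraicGeometry.Resolution.Hironaka2005CompletionOrders
import Literature.AlgebraicGeometry.Resolution.BlowupsEquivariant
import Literature.AlgebraicGeometry.Resolution.NormalCrossingsLocal
import Literature.AlgebraicGeometry.Resolution.BlowupRestrictOpen
import Literature.AlgebraicGeometry.Resolution.EmbeddedResolutionExcellentSurfaces
import HarnessLib

/-!
# DeltaCutMirrorTransport — decomp-res lens-6 (g29 → g30 window row 218 (T-b)): the TRANSPORT FILE, part 1 (§T1–§T3)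

Tree slice 1/2 of the HOME file
`run/shared/lean/pub/decomp-res/decomp-res-lens-6/g29/transport/MirrorTransport.lean` (verbatim §T1–§T3;
§T4–§T6 in `DeltaCutMirrorTransport2`).  TOOL, landable at 0 (row 218).  The ring-level transports EXIST in the tree
(`TwistCutElimination.absContact_transport`, `DeltaCutLaw2.deltaLight_transport`,
`Hironaka2005CompletionOrders.idealOrder_comap_of_isIso_stalkMap`);
this file lifts them to SCHEME level along any morphism with invertible stalk map and deduces the transport of the
BAD LOCUS, its closure,
and the separating hop's STEP-1 data (`BadEmpty`, `badClosure`, `badClosureCentre`, `ClosureRegular`, `SepActive`)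
along isomorphisms (↔/=) and
open immersions into a Jacobson stage (→/=).  No `sorry`, no new axiom, no instance, no notation. [new; elementary] [folklore]
-/

noncomputable section

open CategoryTheory CategoryTheory.Limits AlgebraicGeometry TopologicalSpace IsLocalRing
open Literature.AlgebraicGeometry.Resolution

universe u

namespace Summit.ResolutionOfSingularities.ResolutionOfSingularities.Theorems.DeltaCutClasses

open Summit.ResolutionOfSingularities.ResolutionOfSingularities.Theorems.TwistCutClasses
open Summit.ResolutionOfSingularities.ResolutionOfSingularities.Theorems.LightCutClasses
open Summit.ResolutionOfSingularities.ResolutionOfSingularities.Theorems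
open WeakOrderReduction ForcedTowerClasses SubfieldContactClasses AbsoluteContactClasses PurityValveClasses

section MTransportStalk

variable {X Y : Scheme.{0}} (f : X ⟶ Y) (I : Y.IdealSheafData) (n : ℕ) (x : X)

/-! #### §T1 — stalk-level predicates along a morphism with invertible stalk map -/

/-- the stalk isomorphism of `f` at `x` as a `RingEquiv`, and the stalk ideal of the pulled-back ideal as the image
of the stalk ideal downstairs.
[folklore] -/
theorem exists_stalkEquiv_comap_of_isIso_stalkMap [IsIso (f.stalkMap x)] :
    ∃ e : Y.presheaf.stalk (f.base x) ≃+* X.presheaf.stalk x, stalkIdeal (I.comap f) x = (stalkIdeal I (f.base x)).map e := by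
  refine ⟨(asIso (f.stalkMap x)).commRingCatIsoToRingEquiv, ?_⟩
  rw [stalkIdeal_comap_eq_map_stalkMap]
  rfl

/-- **δ-LIGHTNESS is invariant along a stalk isomorphism**: `DeltaLightAt (I.comap f) n x ↔ DeltaLightAt I n (f x)`.
[new] [folklore] -/
theorem deltaLightAt_comap_iff_of_isIso_stalkMap [IsIso (f.stalkMap x)] :
    DeltaLightAt (I.comap f) n x ↔ DeltaLightAt I n (f.base x) := by
  obtain ⟨e, he⟩ := exists_stalkEquiv_comap_of_isIso_stalkMap f I x
  unfold DeltaLightAt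
  rw [he]
  refine ⟨fun h => ?_, fun h => deltaLight_transport e n h⟩
  have h' := deltaLight_transport e.symm n h
  rwa [CampaignW46.map_map_symm_of_equiv] at h'

/-- **ABSOLUTE STALK CONTACT is invariant along a stalk isomorphism**: `IsAbsContactAt (I.comap f) n x ↔
IsAbsContactAt I n (f x)`. [new] [folklore] -/
theorem isAbsContactAt_comap_iff_of_isIso_stalkMap [IsIso (f.stalkMap x)] :
    IsAbsContactAt (I.comap f) n x ↔ IsAbsContactAt I n (f.base x) := by
  obtain ⟨e, he⟩ := exists_stalkEquiv_comap_of_isIso_stalkMap f I x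
  unfold IsAbsContactAt
  rw [he]
  refine ⟨fun h => ?_, fun h => absContact_transport e (n - 1) h⟩
  have h' := absContact_transport e.symm (n - 1) h
  rwa [CampaignW46.map_map_symm_of_equiv] at h'

/-! #### §T2 — the BAD LOCUS and its closure along isomorphisms and open immersions -/

/-- **pointwise**: if `f.stalkMap x` is invertible and `x` is closed iff `f x` is, then `x ∈ badLocus X (I.comap f)
n ↔ f x ∈ badLocus Y I n`.
[new] [folklore] -/
theorem mem_badLocus_comap_iff_of_isIso_stalkMap [IsIso (f.stalkMap x)]
    (hx : IsClosed ({x} : Set X) ↔ IsClosed ({f.base x} : Set Y)) :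
    x ∈ badLocus X (I.comap f) n ↔ f.base x ∈ badLocus Y I n := by
  simp only [badLocus, Set.mem_setOf_eq, hx, idealOrder_comap_of_isIso_stalkMap f x I,
    deltaLightAt_comap_iff_of_isIso_stalkMap f I n x, isAbsContactAt_comap_iff_of_isIso_stalkMap f I n x]

variable {f I n x}

/-- closed points correspond under an isomorphism of schemes. [folklore] -/
theorem isClosed_singleton_iff_of_isIso (f : X ⟶ Y) [IsIso f] (x : X) :
    IsClosed ({x} : Set X) ↔ IsClosed ({f.base x} : Set Y) := by
  have h := (Scheme.homeoOfIso (asIso f)).isClosed_image (s := ({x} : Set X))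
  rw [Set.image_singleton] at h
  exact h.symm

/-- **THE BAD LOCUS ALONG AN ISOMORPHISM**: `badLocus X (I.comap f) n = f ⁻¹' badLocus Y I n`. [new] [folklore] -/
theorem badLocus_comap_of_isIso (f : X ⟶ Y) [IsIso f] (I : Y.IdealSheafData) (n : ℕ) :
    badLocus X (I.comap f) n = f.base ⁻¹' badLocus Y I n := by
  ext x
  rw [Set.mem_preimage]
  exact mem_badLocus_comap_iff_of_isIso_stalkMap f I n x (isClosed_singleton_iff_of_isIso f x)

/-- closed points of an open immersion's source are the closed points of the (Jacobson) target inside the image. [folklore] -/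
theorem isClosed_singleton_iff_of_isOpenImmersion (f : X ⟶ Y) [IsOpenImmersion f] [JacobsonSpace Y] (x : X) :
    IsClosed ({x} : Set X) ↔ IsClosed ({f.base x} : Set Y) := by
  have h := f.isOpenEmbedding.preimage_closedPoints
  have hx : x ∈ f.base ⁻¹' closedPoints Y ↔ x ∈ closedPoints X := by rw [h]
  rw [Set.mem_preimage, mem_closedPoints_iff, mem_closedPoints_iff] at hx
  exact hx.symm

/-- **THE BAD LOCUS ALONG AN OPEN IMMERSION** (LOCALITY; Jacobson target): `badLocus X (I.comap f) n = f ⁻¹'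
badLocus Y I n`. [new] [folklore] -/
theorem badLocus_comap_of_isOpenImmersion (f : X ⟶ Y) [IsOpenImmersion f] [JacobsonSpace Y] (I : Y.IdealSheafData) (n : ℕ) :
    badLocus X (I.comap f) n = f.base ⁻¹' badLocus Y I n := by
  ext x
  rw [Set.mem_preimage]
  exact mem_badLocus_comap_iff_of_isIso_stalkMap f I n x (isClosed_singleton_iff_of_isOpenImmersion f x)

/-- **THE BAD CLOSURE ALONG AN ISOMORPHISM**: `closure (badLocus X (I.comap f) n) = f ⁻¹' closure (badLocus Y I n)`.
[new] [folklore] -/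
theorem closure_badLocus_comap_of_isIso (f : X ⟶ Y) [IsIso f] (I : Y.IdealSheafData) (n : ℕ) :
    closure (badLocus X (I.comap f) n) = f.base ⁻¹' closure (badLocus Y I n) := by
  rw [badLocus_comap_of_isIso, f.isOpenEmbedding.isOpenMap.preimage_closure_eq_closure_preimage f.base.hom.continuous]

/-- **THE BAD CLOSURE ALONG AN OPEN IMMERSION** (Jacobson target): `closure (badLocus X (I.comap f) n) = f ⁻¹'
closure (badLocus Y I n)` — the closure
in the open of the restricted bad locus is the restriction of the closure. [new] [folklore] -/
theorem closure_badLocus_comap_of_isOpenImmersion (f : X ⟶ Y) [IsOpenImmersion f] [JacobsonSpace Y] (I : Y.IdealSheafData) (n : ℕ) :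
    closure (badLocus X (I.comap f) n) = f.base ⁻¹' closure (badLocus Y I n) := by
  rw [badLocus_comap_of_isOpenImmersion,
    f.isOpenEmbedding.isOpenMap.preimage_closure_eq_closure_preimage f.base.hom.continuous]

end MTransportStalk

section MTransportStage

open Scheme.IdealSheafData (vanishingIdeal)

variable {X Y : Scheme.{0}}

/-! #### §T3 — the separating hop's STEP-1 data (`BadEmpty`, `badClosure`, `badClosureCentre`, `ClosureRegular`,
`SepActive`) along
isomorphisms (↔ / =) and open immersions into a Jacobson stage (→ / =) -/

/-- pulling an ideal sheaf back along an isomorphism and then along its inverse gives it back. [folklore] -/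
theorem comap_comap_inv_of_isIso (f : X ⟶ Y) [IsIso f] (I : Y.IdealSheafData) : (I.comap f).comap (inv f) = I := by
  rw [← Scheme.IdealSheafData.comap_comp, IsIso.inv_hom_id, Scheme.IdealSheafData.comap_id]

/-- **regularity of a closed subscheme is invariant under isomorphisms of the ambient scheme** (both directions, from the tree's
open-immersion restriction `Scheme.IsRegular.subscheme_comap_of_isOpenImmersion`). [folklore] -/
theorem isRegular_subscheme_comap_iff_of_isIso (f : X ⟶ Y) [IsIso f] [IsLocallyNoetherian X] [IsLocallyNoetherian Y]
    (C : Y.IdealSheafData) : Scheme.IsRegular (C.comap f).subscheme ↔ Scheme.IsRegular C.subscheme := by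
  refine ⟨fun h => ?_, fun h => Scheme.IsRegular.subscheme_comap_of_isOpenImmersion f h⟩
  have h' := Scheme.IsRegular.subscheme_comap_of_isOpenImmersion (inv f) h
  rwa [comap_comap_inv_of_isIso] at h'

/-- `BadEmpty` along an isomorphism. [new] [folklore] -/
theorem badEmpty_comap_iff_of_isIso (f : X ⟶ Y) [IsIso f] (I : Y.IdealSheafData) (n : ℕ) :
    BadEmpty n ⟨X, I.comap f⟩ ↔ BadEmpty n ⟨Y, I⟩ := by
  simp only [BadEmpty, badLocus_comap_of_isIso]
  have hs : Function.Surjective f.base := (Scheme.homeoOfIso (asIso f)).surjective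
  constructor
  · intro h
    apply Set.eq_empty_of_forall_notMem
    intro y hy
    obtain ⟨x, rfl⟩ := hs y
    have : x ∈ f.base ⁻¹' badLocus Y I n := hy
    rw [h] at this
    exact this
  · intro h; rw [h, Set.preimage_empty]

/-- `BadEmpty` restricts to opens (Jacobson stage). [new] [folklore] -/
theorem badEmpty_comap_of_isOpenImmersion (f : X ⟶ Y) [IsOpenImmersion f] [JacobsonSpace Y] (I : Y.IdealSheafData) (n : ℕ)
    (h : BadEmpty n ⟨Y, I⟩) : BadEmpty n ⟨X, I.comap f⟩ := by
  simp only [BadEmpty, badLocus_comap_of_isOpenImmersion] at h ⊢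
  rw [h, Set.preimage_empty]

/-- **THE BAD CLOSURE along an isomorphism** (as a closed subset). [new] [folklore] -/
theorem badClosure_comap_of_isIso (f : X ⟶ Y) [IsIso f] (I : Y.IdealSheafData) (n : ℕ) :
    badClosure n ⟨X, I.comap f⟩ = (badClosure n ⟨Y, I⟩).preimage f.base.hom.continuous := by
  apply TopologicalSpace.Closeds.ext
  simp only [badClosure, TopologicalSpace.Closeds.coe_mk, TopologicalSpace.Closeds.coe_preimage]
  exact closure_badLocus_comap_of_isIso f I n

/-- **THE BAD CLOSURE along an open immersion** (Jacobson stage). [new] [folklore] -/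
theorem badClosure_comap_of_isOpenImmersion (f : X ⟶ Y) [IsOpenImmersion f] [JacobsonSpace Y] (I : Y.IdealSheafData) (n : ℕ) :
    badClosure n ⟨X, I.comap f⟩ = (badClosure n ⟨Y, I⟩).preimage f.base.hom.continuous := by
  apply TopologicalSpace.Closeds.ext
  simp only [badClosure, TopologicalSpace.Closeds.coe_mk, TopologicalSpace.Closeds.coe_preimage]
  exact closure_badLocus_comap_of_isOpenImmersion f I n

/-- **THE STEP-1 CENTRE IS EQUIVARIANT**: along an isomorphism `f`, `(badClosureCentre n ⟨Y, I⟩).comap f =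
badClosureCentre n ⟨X, I.comap f⟩`
— the reduced closure of the bad locus pulls back to the reduced closure of the bad locus. [new] [folklore] -/
theorem badClosureCentre_comap_of_isIso (f : X ⟶ Y) [IsIso f] (I : Y.IdealSheafData) (n : ℕ) :
    (badClosureCentre n ⟨Y, I⟩).comap f = badClosureCentre n ⟨X, I.comap f⟩ := by
  have h := vanishingIdeal_comap_hom (asIso f) (badClosure n ⟨Y, I⟩)
  rw [← badClosureCentre_eq_vanishingIdeal] at h
  change (badClosureCentre n ⟨Y, I⟩).comap f = _ at h
  rw [h, badClosureCentre_eq_vanishingIdeal, badClosure_comap_of_isIso]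
  rfl

/-- **THE STEP-1 CENTRE IS LOCAL**: along an open immersion `f` into a Jacobson stage,
`(badClosureCentre n ⟨Y, I⟩).comap f = badClosureCentre n ⟨X, I.comap f⟩`. [new] [folklore] -/
theorem badClosureCentre_comap_of_isOpenImmersion (f : X ⟶ Y) [IsOpenImmersion f] [JacobsonSpace Y] (I : Y.IdealSheafData) (n : ℕ) :
    (badClosureCentre n ⟨Y, I⟩).comap f = badClosureCentre n ⟨X, I.comap f⟩ := by
  rw [badClosureCentre_eq_vanishingIdeal, badClosureCentre_eq_vanishingIdeal, comap_vanishingIdeal_of_isOpenImmersion,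
    badClosure_comap_of_isOpenImmersion]

/-- `ClosureRegular` along an isomorphism (locally Noetherian stages). [new] [folklore] -/
theorem closureRegular_comap_iff_of_isIso (f : X ⟶ Y) [IsIso f] [IsLocallyNoetherian X] [IsLocallyNoetherian Y]
    (I : Y.IdealSheafData) (n : ℕ) : ClosureRegular n ⟨X, I.comap f⟩ ↔ ClosureRegular n ⟨Y, I⟩ := by
  unfold ClosureRegular
  rw [← badClosureCentre_comap_of_isIso]
  exact isRegular_subscheme_comap_iff_of_isIso f _

/-- `ClosureRegular` restricts to opens (Jacobson, locally Noetherian stage). [new] [folklore] -/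
theorem closureRegular_comap_of_isOpenImmersion (f : X ⟶ Y) [IsOpenImmersion f] [JacobsonSpace Y] [IsLocallyNoetherian Y]
    (I : Y.IdealSheafData) (n : ℕ) (h : ClosureRegular n ⟨Y, I⟩) : ClosureRegular n ⟨X, I.comap f⟩ := by
  unfold ClosureRegular at h ⊢
  rw [← badClosureCentre_comap_of_isOpenImmersion]
  exact Scheme.IsRegular.subscheme_comap_of_isOpenImmersion f h

/-- `SepActive` (the separating hop MOVES) along an isomorphism. [new] [folklore] -/
theorem sepActive_comap_iff_of_isIso (f : X ⟶ Y) [IsIso f] [IsLocallyNoetherian X] [IsLocallyNoetherian Y]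
    (I : Y.IdealSheafData) (n : ℕ) : SepActive n ⟨X, I.comap f⟩ ↔ SepActive n ⟨Y, I⟩ := by
  unfold SepActive
  rw [badEmpty_comap_iff_of_isIso, closureRegular_comap_iff_of_isIso]

end MTransportStage


end Summit.ResolutionOfSingularities.ResolutionOfSingularities.Theorems.DeltaCutClasses
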